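import Literature.Geometry.DiscreteGeometry.OneSidedKissingNumberThree
import HarnessLib

/-!
# The one-sided kissing bound `B(3) = 9` in labelled-packing language, and the
# "three contacts strictly on each side" corollary for twelve-coordinated balls

Topic `Literature/Geometry/DiscreteGeometry`.  Cite item `wi-69005` (family `hilbert6`, venture
`Summits/Ventures/Crystal3D`, crux `LiminfAssembly` / tenure child `BoundaryCostFloor`) asked for the
one-sided kissing number `B(3) = 9` (G. Fejes Tóth 1981; K. Bezdek, *Classical Topics*, Thm 1.2.1;
Musin 2006, Cor. 1) "in the packing language of `Summits/Ventures/Crystal3D`, `d = 3`": for a unit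
packing `x : Fin N → ℝ³` (diameter-`1` balls: distinct centres at distance `≥ 1`, contact = distance
exactly `1` — the body of the venture's `Summit.Ventures.Crystal3D.IsUnitPacking`, restated here as the
hypothesis `Pairwise fun i j => 1 ≤ dist (x i) (x j)` so that `IsUnitPacking x` feeds it definitionally),
an index `i` and any non-zero vector `u`,
`#{j ≠ i : dist (x j) (x i) = 1 ∧ ⟪x j − x i, u⟫ ≤ 0} ≤ 9`.

The fact itself is ALREADY IN THE TREE AND PROVED — `fejesTothG1981_oneSidedKissing_three` /
`fejesTothG1981_oneSidedKissing_three_holds` (`OneSidedKissingNumberThree.lean`, Musin's chordal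
form: unit vectors in a closed hemisphere pairwise at distance `≥ 1` number at most nine).  This file
is the thin PROVED transport to the labelled-packing form (the contact displacement vectors
`x j − x i` of the one-sided contact neighbours are such a hemispherical code; distinct labels give
distinct vectors because a unit packing is injective), plus the corollary the route consumes:

* `card_oneSidedContacts_le_nine` — the displayed bound (any `u ≠ 0`; closed half-space `⟪·, u⟫ ≤ 0`);
* `card_oneSidedContacts_le_nine'` — the same for the closed half-space `0 ≤ ⟪·, u⟫`;
* ★ `three_le_card_contacts_open_halfspace` — **a ball with twelve contacts has at least three
  contact neighbours STRICTLY on each side of every plane through its centre**: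
  `#{j ≠ i : dist (x j) (x i) = 1} = 12 ⇒ 3 ≤ #{j ≠ i : dist (x j) (x i) = 1 ∧ 0 < ⟪x j − x i, u⟫}`
  (and, with `−u`, `… ∧ ⟪x j − x i, u⟫ < 0`: `three_le_card_contacts_open_halfspace'`), since the
  complementary closed half-space holds at most `9` of the `12`.

WHAT THIS IS NOT: the two-sided kissing number `k(3) = 12` (tree: `musin2006_kissing_three_holds`,
`FejesTothKissingTwelve`); uniqueness of the extremal nine (Kertész 1994) is not used or stated.
Everything is proved; no definition, no named fact.

## References

* G. Fejes Tóth, *Ten-neighbour packing of equal balls*, Period. Math. Hungar. 12 (1981) 125–127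
  (`B(3) = 9`). [FejesTothG1981]
* K. Bezdek, *Classical Topics in Discrete Geometry*, CMS Books (Springer 2010), §1.2 Thm 1.2.1.
  [Bezdek2010]
* O. R. Musin, *The one-sided kissing number in four dimensions*, Period. Math. Hungar. 53 (2006)
  209–225 = arXiv:math/0511071, §2 Cor. 1 (p. 2 of the arXiv version). [Musin2006]
-/

noncomputable section

namespace Literature.Geometry.DiscreteGeometry

open Real RealInnerProductSpace Finset

variable {N : ℕ} {x : Fin N → EuclideanSpace ℝ (Fin 3)}

/-- **`B(3) ≤ 9` for labelled unit packings (closed half-space `⟪·, u⟫ ≤ 0`).**  In a unit packing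
(distinct centres at distance `≥ 1`), the contact neighbours `j` of ball `i` (`dist (x j) (x i) = 1`)
whose displacement `x j − x i` lies in a closed half-space `⟪x j − x i, u⟫ ≤ 0` (`u ≠ 0`) through the
centre of ball `i` number at most nine.  Proof: the displacements are unit vectors in the closed
hemisphere `⟪−u, ·⟫ ≥ 0`, pairwise at distance `dist (x j) (x j') ≥ 1`, distinct for distinct labels;
apply `fejesTothG1981_oneSidedKissing_three_holds`.
[cite: FejesTothG1981, Theorem (B(3) = 9)] [cite: Bezdek2010, Thm 1.2.1] [cite: Musin2006, §2 Cor. 1] -/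
theorem card_oneSidedContacts_le_nine [DecidableEq (Fin N)]
    (hx : Pairwise fun i j => 1 ≤ dist (x i) (x j)) (i : Fin N)
    {u : EuclideanSpace ℝ (Fin 3)} (hu : u ≠ 0)
    [DecidablePred fun j : Fin N => j ≠ i ∧ dist (x j) (x i) = 1 ∧ ⟪x j - x i, u⟫ ≤ 0] :
    (univ.filter fun j : Fin N => j ≠ i ∧ dist (x j) (x i) = 1 ∧ ⟪x j - x i, u⟫ ≤ 0).card ≤ 9 := by
  classical
  set S := univ.filter fun j : Fin N => j ≠ i ∧ dist (x j) (x i) = 1 ∧ ⟪x j - x i, u⟫ ≤ 0 with hS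
  -- the displacement map is injective (a unit packing has distinct centres)
  have hinj : Set.InjOn (fun j : Fin N => x j - x i) S := by
    intro j _ j' _ h
    by_contra hjj'
    have h1 : 1 ≤ dist (x j) (x j') := hx hjj'
    have h2 : x j = x j' := sub_left_injective h
    rw [h2, dist_self] at h1
    exact absurd h1 (by norm_num)
  rw [← Finset.card_image_of_injOn hinj]
  refine fejesTothG1981_oneSidedKissing_three_holds (-u) (neg_ne_zero.2 hu) _ ?_ ?_ ?_
  · intro v hv
    obtain ⟨j, hj, rfl⟩ := Finset.mem_image.1 hv
    have hd := (Finset.mem_filter.1 hj).2.2.1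
    rwa [dist_eq_norm] at hd
  · intro v hv
    obtain ⟨j, hj, rfl⟩ := Finset.mem_image.1 hv
    have hle := (Finset.mem_filter.1 hj).2.2.2
    rw [inner_neg_left, real_inner_comm]
    linarith
  · intro v hv w hw hvw
    obtain ⟨j, hj, rfl⟩ := Finset.mem_image.1 hv
    obtain ⟨j', hj', rfl⟩ := Finset.mem_image.1 hw
    have hjj' : j ≠ j' := fun h => hvw (by rw [h])
    rw [dist_sub_right]
    exact hx hjj'

/-- **`B(3) ≤ 9` for labelled unit packings (closed half-space `0 ≤ ⟪·, u⟫`).**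
[cite: FejesTothG1981, Theorem (B(3) = 9)] [cite: Bezdek2010, Thm 1.2.1] [cite: Musin2006, §2 Cor. 1] -/
theorem card_oneSidedContacts_le_nine' [DecidableEq (Fin N)]
    (hx : Pairwise fun i j => 1 ≤ dist (x i) (x j)) (i : Fin N)
    {u : EuclideanSpace ℝ (Fin 3)} (hu : u ≠ 0)
    [DecidablePred fun j : Fin N => j ≠ i ∧ dist (x j) (x i) = 1 ∧ 0 ≤ ⟪x j - x i, u⟫] :
    (univ.filter fun j : Fin N => j ≠ i ∧ dist (x j) (x i) = 1 ∧ 0 ≤ ⟪x j - x i, u⟫).card ≤ 9 := by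
  classical
  have h := card_oneSidedContacts_le_nine hx i (neg_ne_zero.2 hu)
  have hset : (univ.filter fun j : Fin N => j ≠ i ∧ dist (x j) (x i) = 1 ∧ 0 ≤ ⟪x j - x i, u⟫) =
      univ.filter fun j : Fin N => j ≠ i ∧ dist (x j) (x i) = 1 ∧ ⟪x j - x i, -u⟫ ≤ 0 := by
    refine Finset.filter_congr fun j _ => ?_
    rw [inner_neg_right, neg_nonpos]
  rw [hset]
  convert h

/-- **Three contacts strictly on each side.**  If ball `i` of a unit packing has exactly twelve
contact neighbours (the kissing number), then for every `u ≠ 0` at least three of them lie STRICTLY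
on the positive side of the plane `⟪· − x i, u⟫ = 0` (the closed non-positive side holds at most
nine of the twelve, `card_oneSidedContacts_le_nine`).
[cite: FejesTothG1981, Theorem (B(3) = 9)] [cite: Bezdek2010, Thm 1.2.1] [cite: Musin2006, §2 Cor. 1] -/
theorem three_le_card_contacts_open_halfspace [DecidableEq (Fin N)]
    (hx : Pairwise fun i j => 1 ≤ dist (x i) (x j)) (i : Fin N)
    {u : EuclideanSpace ℝ (Fin 3)} (hu : u ≠ 0)
    [DecidablePred fun j : Fin N => j ≠ i ∧ dist (x j) (x i) = 1]
    [DecidablePred fun j : Fin N => j ≠ i ∧ dist (x j) (x i) = 1 ∧ 0 < ⟪x j - x i, u⟫]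
    (h12 : (univ.filter fun j : Fin N => j ≠ i ∧ dist (x j) (x i) = 1).card = 12) :
    3 ≤ (univ.filter fun j : Fin N => j ≠ i ∧ dist (x j) (x i) = 1 ∧ 0 < ⟪x j - x i, u⟫).card := by
  classical
  have h9 := card_oneSidedContacts_le_nine hx i hu
  -- split the twelve contacts by the sign of `⟪x j − x i, u⟫`
  have hsplit := Finset.card_filter_add_card_filter_not
    (s := univ.filter fun j : Fin N => j ≠ i ∧ dist (x j) (x i) = 1) (fun j => ⟪x j - x i, u⟫ ≤ 0)
  rw [Finset.filter_filter, Finset.filter_filter, h12] at hsplit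
  have hA : (univ.filter fun j : Fin N => (j ≠ i ∧ dist (x j) (x i) = 1) ∧ ⟪x j - x i, u⟫ ≤ 0).card ≤ 9 := by
    have hset : (univ.filter fun j : Fin N => (j ≠ i ∧ dist (x j) (x i) = 1) ∧ ⟪x j - x i, u⟫ ≤ 0) =
        univ.filter fun j : Fin N => j ≠ i ∧ dist (x j) (x i) = 1 ∧ ⟪x j - x i, u⟫ ≤ 0 :=
      Finset.filter_congr fun j _ => and_assoc
    rw [hset]
    convert h9
  have hB : (univ.filter fun j : Fin N => (j ≠ i ∧ dist (x j) (x i) = 1) ∧ ¬ ⟪x j - x i, u⟫ ≤ 0).card =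
      (univ.filter fun j : Fin N => j ≠ i ∧ dist (x j) (x i) = 1 ∧ 0 < ⟪x j - x i, u⟫).card := by
    have hset : (univ.filter fun j : Fin N => (j ≠ i ∧ dist (x j) (x i) = 1) ∧ ¬ ⟪x j - x i, u⟫ ≤ 0) =
        univ.filter fun j : Fin N => j ≠ i ∧ dist (x j) (x i) = 1 ∧ 0 < ⟪x j - x i, u⟫ :=
      Finset.filter_congr fun j _ => by rw [not_le, and_assoc]
    rw [hset]
  omega

/-- **Three contacts strictly on each side (negative side).**  Same as
`three_le_card_contacts_open_halfspace` for the open half-space `⟪x j − x i, u⟫ < 0`.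
[cite: FejesTothG1981, Theorem (B(3) = 9)] [cite: Bezdek2010, Thm 1.2.1] [cite: Musin2006, §2 Cor. 1] -/
theorem three_le_card_contacts_open_halfspace' [DecidableEq (Fin N)]
    (hx : Pairwise fun i j => 1 ≤ dist (x i) (x j)) (i : Fin N)
    {u : EuclideanSpace ℝ (Fin 3)} (hu : u ≠ 0)
    [DecidablePred fun j : Fin N => j ≠ i ∧ dist (x j) (x i) = 1]
    [DecidablePred fun j : Fin N => j ≠ i ∧ dist (x j) (x i) = 1 ∧ ⟪x j - x i, u⟫ < 0]
    (h12 : (univ.filter fun j : Fin N => j ≠ i ∧ dist (x j) (x i) = 1).card = 12) :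
    3 ≤ (univ.filter fun j : Fin N => j ≠ i ∧ dist (x j) (x i) = 1 ∧ ⟪x j - x i, u⟫ < 0).card := by
  classical
  have h := three_le_card_contacts_open_halfspace hx i (neg_ne_zero.2 hu) h12
  have hset : (univ.filter fun j : Fin N => j ≠ i ∧ dist (x j) (x i) = 1 ∧ ⟪x j - x i, u⟫ < 0) =
      univ.filter fun j : Fin N => j ≠ i ∧ dist (x j) (x i) = 1 ∧ 0 < ⟪x j - x i, -u⟫ := by
    refine Finset.filter_congr fun j _ => ?_
    rw [inner_neg_right, neg_pos]
  rw [hset]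
  convert h

end Literature.Geometry.DiscreteGeometry

end
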